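/-
Copyright (c) 2026. Released under the Apache 2.0 license.
-/
import Literature.NumberTheory.EllipticCurves.ManinConstantClassCertificateEdixhoven
import Literature.NumberTheory.EllipticCurves.ManinConstantQuadraticTwistClassCertificate
import Literature.NumberTheory.EllipticCurves.IsogenyIdProofs
import HarnessLib

/-!
# A fifth source of `ClassAbsManinConstantEqOne W`: at each square prime, EITHER Edixhoven 1991
# Thm. 3 (`p ≥ 11`, outside the printed exception) OR the twist road (the class is the
# `χ_{q*}`-twist of a class semistable at `q`, with the torsion clause at `q ≤ 7`)

Topic `Literature/NumberTheory/EllipticCurves`; namespace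
`Literature.NumberTheory.EllipticCurves.ModularForms`. TWO definitions (predicates with free curve
arguments; nothing is asserted, no named fact is introduced) and PROVED theorems.

`ManinConstantClassCertificateEdixhoven.lean` proves `ClassAbsManinConstantEqOne W` (the Manin
constant of the `X₀(N)`-optimal curve of the class of `W` is `±1`) for the "Edixhoven–Česnavičius
covered" classes: every square prime `p` of the conductor is `> 7` and every globally minimal member
is outside Edixhoven's printed exception at `p`. `ManinConstantQuadraticTwistClassCertificate.lean`
proves, per (class, odd prime `q`), `q ∤ c₀` for a class that is the `χ_{q*}`-twist of a class
semistable at `q` — the kernel form of Edixhoven 1991 §1's `I₀*/I_ν*` clause for `q ≥ 11` (token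
`Edi91-Thm3-I0*/In*-limb@MS-sketch` of the pub-bsdpct census, referee C4 ROUND C4-R2) and, for
`q ∈ {3, 5, 7}`, of the twist lever of the bsd-litref MANIN audit (ADDENDUM-1 §B, "T-TWIST-SMALLP")
under the torsion clause. This file merges the two, prime by prime:

* `TwistSemistableWitnessAt W' q` — the per-(member, prime) DISPLAYED hypothesis of the twist road:
  `q ≠ 2` and there is a globally minimal elliptic `V` (a member of the twisted class) with
  `W' ∼ V.quadraticTwist q*`, `N(V) ∣ N(W')`, `N(V)·q ∣ N(W')`, `q² ∤ N(V)`, `W'` additive at `q`,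
  and (`q ≥ 11` or no globally minimal member of the class of `W'` has `q ∣ #E(ℚ)_tors`).
* `IsEdixhovenCesnaviciusTwistCovered W` — at every square prime `p` of the conductor of every
  globally minimal member `W'` of the class: `(7 < p ∧ EdixhovenNonexceptionalAt W' p)` OR
  `TwistSemistableWitnessAt W' p`.
* `classAbsManinConstantEqOne_of_isEdixhovenCesnaviciusTwistCovered` — **under the named facts
  (Mazur 1978 / Abbes–Ullmo / Česnavičius at `2 ∥ N`; Edixhoven Thm. 3 both halves; modularity;
  Stevens (1.4) and (5.2); Néron scaling; Česnavičius Lemma 2.12; ČNS Lemma 6.5; Mazur's torsion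
  theorem), a covered class has `ClassAbsManinConstantEqOne W`**, and the binder form
  `not_dvd_maninConstant_of_isEdixhovenCesnaviciusTwistCovered`.

Nothing here is new mathematics beyond the files it imports: prime by prime, `p² ∤ N` is
Česnavičius 2018 Thm. 1.2 (`cesnavicius2018_not_dvd_maninConstant_of_not_sq_dvd_level`), the left
disjunct is Edixhoven (`hEA`/`hEB`), the right disjunct is
`not_dvd_maninConstant_of_isTwistOfSemistableAt` applied with `W₀ := W'` itself.

## References
* [EdixhovenManin1991] B. Edixhoven, Progr. Math. 89 (1991), §1 (typescript L92–101, L119–122),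
  Thm. 3.
* [Stevens1989] G. Stevens, Invent. Math. 98 (1989), Prop. (1.4), §5 Lemmas (5.2), (5.4).
* [Cesnavicius2018] K. Česnavičius, Compositio Math. 154 (2018), Thm. 1.2, Lemma 2.12.
* [Mazur1977] B. Mazur, Publ. Math. IHÉS 47 (1977), Thm. (7').
-/

noncomputable section

open scoped MatrixGroups ModularForm

open CongruenceSubgroup WeierstrassCurve

namespace Literature.NumberTheory.EllipticCurves.ModularForms

/-! ### The per-(member, prime) hypothesis of the twist road -/

/-- **"At the odd prime `q`, the class of `W'` is the `χ_{q*}`-twist of a class semistable at `q`,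
with witness and bookkeeping displayed"** — the hypothesis shape of
`not_dvd_maninConstant_of_isTwistOfSemistableAt`: `q ≠ 2`; a globally minimal elliptic `V` with
`W' ∼ V ⊗ χ_{q*}` (`q* = (−1)^{(q−1)/2} q`); `N(V) ∣ N(W')`, `N(V)·q ∣ N(W')`, `q² ∤ N(V)`; `W'`
has additive reduction at `q`; and either `q ≥ 11` (Mazur's torsion theorem applies) or no globally
minimal member of the class of `W'` has rational torsion of order divisible by `q`. For `q ≥ 5` the
existence of such `V` is Kodaira type `I₀*`/`I_ν*` at `q` (Edixhoven 1991 §1: "primes `p > 7` where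
`E` has reduction type `I₀*` or `I_ν*`"; Tate's algorithm — a dictionary not used here: the witness
is displayed). A predicate; nothing asserted. [cite: EdixhovenManin1991, §1]
[cite: Stevens1989, §5 Thm. (5.1) and Lemma (5.2) (the twisting hypothesis)] -/
def TwistSemistableWitnessAt (W' : WeierstrassCurve ℚ) (q : ℕ) [Fact q.Prime] : Prop :=
  q ≠ 2 ∧ ∃ (V : WeierstrassCurve ℚ) (_ : V.IsElliptic) (_ : V.IsGloballyMinimal),
    IsIsogenous W' (V.quadraticTwist (((-1 : ℤ) ^ (q / 2) * q : ℤ) : ℚ)) ∧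
    V.conductorNorm ℤ ∣ W'.conductorNorm ℤ ∧ V.conductorNorm ℤ * q ∣ W'.conductorNorm ℤ ∧
    ¬ q ^ 2 ∣ V.conductorNorm ℤ ∧
    (¬ W'.HasGoodReductionAtPrime q ∧ ¬ W'.HasMultiplicativeReductionAtPrime q) ∧
    (11 ≤ q ∨ ∀ (U : WeierstrassCurve ℚ) [U.IsElliptic] [U.IsGloballyMinimal],
      IsIsogenous W' U → ¬ q ∣ U.torsionOrder)

/-- **The "Edixhoven–Česnavičius–twist covered" classes**: at every square prime `p` of the
conductor of every globally minimal member `W'` of the class of `W`, either `p > 7` and `W'` is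
outside Edixhoven's printed exception (`EdixhovenNonexceptionalAt`, as in
`IsEdixhovenCesnaviciusCovered`), or the twist road applies (`TwistSemistableWitnessAt W' p`).
A predicate; nothing asserted. [cite: EdixhovenManin1991, §1 and Thm. 3]
[cite: Cesnavicius2018, Thm. 1.2] -/
def IsEdixhovenCesnaviciusTwistCovered (W : WeierstrassCurve ℚ) : Prop :=
  ∀ (W' : WeierstrassCurve ℚ) [W'.IsElliptic] [W'.IsGloballyMinimal], IsIsogenous W W' →
    ∀ (p : ℕ) (hp : p.Prime), p ^ 2 ∣ W'.conductorNorm ℤ →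
      (7 < p ∧ EdixhovenNonexceptionalAt W' p hp) ∨
        @TwistSemistableWitnessAt W' p ⟨hp⟩

/-- Unfolding of `IsEdixhovenCesnaviciusTwistCovered` (by `Iff.rfl`).
[cite: EdixhovenManin1991, §1 and Thm. 3] -/
theorem isEdixhovenCesnaviciusTwistCovered_iff (W : WeierstrassCurve ℚ) :
    IsEdixhovenCesnaviciusTwistCovered W ↔
      ∀ (W' : WeierstrassCurve ℚ) [W'.IsElliptic] [W'.IsGloballyMinimal], IsIsogenous W W' →
        ∀ (p : ℕ) (hp : p.Prime), p ^ 2 ∣ W'.conductorNorm ℤ →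
          (7 < p ∧ EdixhovenNonexceptionalAt W' p hp) ∨
            @TwistSemistableWitnessAt W' p ⟨hp⟩ :=
  Iff.rfl

/-- An Edixhoven–Česnavičius covered class is Edixhoven–Česnavičius–twist covered (the left
disjunct everywhere). [cite: EdixhovenManin1991, Thm. 3] -/
theorem IsEdixhovenCesnaviciusCovered.twistCovered {W : WeierstrassCurve ℚ}
    (h : IsEdixhovenCesnaviciusCovered W) : IsEdixhovenCesnaviciusTwistCovered W :=
  fun W' _ _ hiso p hp hsq ↦ Or.inl (h W' hiso p hp hsq)

/-! ### From additive reduction at `q` to `q² ∣ N` -/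

/-- **Additive reduction at `q` gives `q² ∣ N(V)`** (`f_q ≥ 2` iff additive, Silverman ATAEC
IV.10.2(c); tree `natGenerator_sq_dvd_conductorNorm_iff` at the `ℤ`-place over `q`, the local
trichotomy, and the `ℚ_v`/`ℚ_[q]` bridges of `ManinConstantQuadraticTwistClassCertificate.lean`).
[cite: Silverman1994, IV.10.2(c)] -/
theorem sq_dvd_conductorNorm_of_not_good_of_not_mult {V : WeierstrassCurve ℚ} [V.IsElliptic]
    {q : ℕ} [Fact q.Prime]
    (hadd : ¬ V.HasGoodReductionAtPrime q ∧ ¬ V.HasMultiplicativeReductionAtPrime q) :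
    q ^ 2 ∣ V.conductorNorm ℤ := by
  have hqp : q.Prime := Fact.out
  set v : IsDedekindDomain.HeightOneSpectrum ℤ :=
    (Rat.HeightOneSpectrum.primesEquiv (R := ℤ)).symm ⟨q, hqp⟩ with hv
  have hpv : (Rat.HeightOneSpectrum.primesEquiv v : ℕ) = q :=
    congrArg Subtype.val ((Rat.HeightOneSpectrum.primesEquiv (R := ℤ)).apply_symm_apply ⟨q, hqp⟩)
  have hgen : Rat.HeightOneSpectrum.natGenerator v = q := natGenerator_primesEquiv_symm hqp
  rw [← hgen, natGenerator_sq_dvd_conductorNorm_iff v V]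
  rcases hasGoodReductionAt_or_hasMultiplicativeReductionAt_or_hasAdditiveReductionAt v V with
    hg | hm | ha
  · exact absurd (hasGoodReductionAtPrime_or_hasMultiplicativeReductionAtPrime_of_place hpv
      (Or.inl hg)) (not_or.mpr hadd)
  · exact absurd (hasGoodReductionAtPrime_or_hasMultiplicativeReductionAtPrime_of_place hpv
      (Or.inr hm)) (not_or.mpr hadd)
  · exact ha

/-! ### The fifth printed-input source of `ClassAbsManinConstantEqOne` -/

/-- **Per prime, per member: the twist road gives `q ∤ c` for the optimal datum of the member.**
From `TwistSemistableWitnessAt W' q` and the facts, every lattice-optimal `X₀`-datum `D'` of the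
globally minimal `W'` has `q ∤ D'.maninConstant` (`not_dvd_maninConstant_of_isTwistOfSemistableAt`
with `W₀ := W'`; `q² ∣ N(W')` from additivity; the torsion clause from the witness or, for
`q ≥ 11`, from Mazur). [cite: EdixhovenManin1991, §1]
[cite: Stevens1989, Prop. (1.4), Lemmas (5.2), (5.4)] [cite: Cesnavicius2018, Thm. 1.2 and Lemma 2.12] -/
theorem not_dvd_maninConstant_of_twistSemistableWitnessAt
    (h14 : stevens1989_exists_optimal_gamma1ParametrizationData)
    (h52 : stevens1989_neronLattice_quadraticTwist_oddPrime)
    (hNS : integral_neronScaling_of_isGloballyMinimal)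
    (h212 : cesnavicius2018_lemma_2_12_constKernel)
    (h65 : cesnaviciusNeururerSaha_lemma_6_5_dvd) (hnf : exists_isNewformOf)
    (hM : mazur_not_dvd_maninConstant_of_odd)
    (hAU : abbesUllmo_not_dvd_maninConstant_of_not_dvd_level)
    (hC2 : cesnavicius_not_two_dvd_maninConstant_of_two_dvd_level)
    (hMz : ∀ V : WeierstrassCurve ℚ, Mazur1977_addOrderOf_le V)
    (W' : WeierstrassCurve ℚ) [W'.IsElliptic] [W'.IsGloballyMinimal] {N' : ℕ} [NeZero N']
    (D' : ModularParametrizationData W' N')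
    (hopt : ∀ z ∈ D'.L.lattice, ∃ w ∈ periodLattice D'.f, z = D'.c * w)
    {q : ℕ} [Fact q.Prime] (htw : TwistSemistableWitnessAt W' q) :
    ¬ (q : ℤ) ∣ D'.maninConstant := by
  obtain ⟨hq2, V, hVE, hVM, hiso, hdvd, hdvdq, hsq, hadd, htors⟩ := htw
  haveI := hVE
  haveI := hVM
  have htors' : ∀ (U : WeierstrassCurve ℚ) [U.IsElliptic] [U.IsGloballyMinimal],
      IsIsogenous W' U → ¬ q ∣ U.torsionOrder := by
    rcases htors with h11 | h
    · exact fun U _ _ _ ↦ not_dvd_torsionOrder_of_mazur U (hMz U) (Fact.out : q.Prime) h11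
    · exact h
  exact not_dvd_maninConstant_of_isTwistOfSemistableAt h14 h52 hNS h212 h65 hnf hM hAU hC2 hq2 hiso
    hdvd (sq_dvd_conductorNorm_of_not_good_of_not_mult hadd) hdvdq hsq hadd htors' W' D'
    (IsIsogenous.refl_holds W') hopt

/-- **Edixhoven 1991 Thm. 3 OR the twist road at each square prime, + Česnavičius 2018 Thm. 1.2 at
the others, per class.** Under the named facts (the five of
`classAbsManinConstantEqOne_of_isEdixhovenCesnaviciusCovered`, and Stevens (1.4)/(5.2), Néron
scaling, Česnavičius Lemma 2.12, ČNS Lemma 6.5, Mazur's torsion theorem): if the class of `W` is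
Edixhoven–Česnavičius–twist covered, the Manin constant of its optimal curve is `±1`
(`ClassAbsManinConstantEqOne W`): for an optimal datum `D'` of a globally minimal member `W'` and a
prime `p`, either `p² ∤ N(W')` (Česnavičius), or `p² ∣ N(W')` and then Edixhoven (left disjunct)
or `not_dvd_maninConstant_of_twistSemistableWitnessAt` (right disjunct) gives `p ∤ c`.
[cite: EdixhovenManin1991, §1 and Thm. 3] [cite: Cesnavicius2018, Thm. 1.2 and Lemma 2.12]
[cite: Stevens1989, Prop. (1.4), Lemmas (5.2), (5.4)] -/
theorem classAbsManinConstantEqOne_of_isEdixhovenCesnaviciusTwistCovered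
    (hM : mazur_not_dvd_maninConstant_of_odd)
    (hAU : abbesUllmo_not_dvd_maninConstant_of_not_dvd_level)
    (hC : cesnavicius_not_two_dvd_maninConstant_of_two_dvd_level)
    (hEA : edixhoven_not_dvd_maninConstant_of_not_potentiallyGoodOrdinary)
    (hEB : edixhoven_not_dvd_maninConstant_of_kodairaSymbol_ne)
    (hnf : exists_isNewformOf)
    (h14 : stevens1989_exists_optimal_gamma1ParametrizationData)
    (h52 : stevens1989_neronLattice_quadraticTwist_oddPrime)
    (hNS : integral_neronScaling_of_isGloballyMinimal)
    (h212 : cesnavicius2018_lemma_2_12_constKernel)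
    (h65 : cesnaviciusNeururerSaha_lemma_6_5_dvd)
    (hMz : ∀ V : WeierstrassCurve ℚ, Mazur1977_addOrderOf_le V)
    (W : WeierstrassCurve ℚ) (hcov : IsEdixhovenCesnaviciusTwistCovered W) :
    ClassAbsManinConstantEqOne W := by
  intro W' _ _ N' _ D' hiso hopt
  have hN' : N' = W'.conductorNorm ℤ :=
    IsNewformOf.level_eq_conductorNorm_of_exists_isNewformOf hnf D'.isNewformOf
  subst hN'
  refine D'.abs_maninConstant_eq_one_of_forall_prime_not_dvd fun p hp ↦ ?_
  by_cases hsq : p ^ 2 ∣ W'.conductorNorm ℤ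
  · rcases hcov W' hiso p hp hsq with ⟨h7, hne | hG⟩ | htw
    · exact hEB W' D' hopt p hp h7 hne.1 hne.2.1 hne.2.2
    · exact hEA W' D' hopt p hp h7 hG
    · haveI : Fact p.Prime := ⟨hp⟩
      exact not_dvd_maninConstant_of_twistSemistableWitnessAt h14 h52 hNS h212 h65 hnf hM hAU hC
        hMz W' D' hopt htw
  · exact cesnavicius2018_not_dvd_maninConstant_of_not_sq_dvd_level hM hAU hC W' D' hopt hp hsq

/-- The binder form carried by consumers: under the same facts, for a covered class, `p ∤ c` for
EVERY prime `p` and every optimal datum of every globally minimal member.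
[cite: EdixhovenManin1991, §1 and Thm. 3] [cite: Cesnavicius2018, Thm. 1.2] -/
theorem not_dvd_maninConstant_of_isEdixhovenCesnaviciusTwistCovered
    (hM : mazur_not_dvd_maninConstant_of_odd)
    (hAU : abbesUllmo_not_dvd_maninConstant_of_not_dvd_level)
    (hC : cesnavicius_not_two_dvd_maninConstant_of_two_dvd_level)
    (hEA : edixhoven_not_dvd_maninConstant_of_not_potentiallyGoodOrdinary)
    (hEB : edixhoven_not_dvd_maninConstant_of_kodairaSymbol_ne)
    (hnf : exists_isNewformOf)
    (h14 : stevens1989_exists_optimal_gamma1ParametrizationData)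
    (h52 : stevens1989_neronLattice_quadraticTwist_oddPrime)
    (hNS : integral_neronScaling_of_isGloballyMinimal)
    (h212 : cesnavicius2018_lemma_2_12_constKernel)
    (h65 : cesnaviciusNeururerSaha_lemma_6_5_dvd)
    (hMz : ∀ V : WeierstrassCurve ℚ, Mazur1977_addOrderOf_le V)
    {W : WeierstrassCurve ℚ} (hcov : IsEdixhovenCesnaviciusTwistCovered W)
    (W' : WeierstrassCurve ℚ) [W'.IsElliptic] [W'.IsGloballyMinimal] {N' : ℕ} [NeZero N']
    (D' : ModularParametrizationData W' N') (hiso : IsIsogenous W W')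
    (hopt : ∀ z ∈ D'.L.lattice, ∃ w ∈ periodLattice D'.f, z = D'.c * w)
    (p : ℕ) (hp : p.Prime) : ¬ (p : ℤ) ∣ D'.maninConstant :=
  (classAbsManinConstantEqOne_of_isEdixhovenCesnaviciusTwistCovered hM hAU hC hEA hEB hnf h14 h52 hNS
    h212 h65 hMz W hcov).not_dvd_maninConstant D' hiso hopt hp

end Literature.NumberTheory.EllipticCurves.ModularForms

end
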